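import Mathlib
import HarnessLib

/-!
# QUANT lane R8, FAR for independent blobs (I): Bernoulli product weights on `Finset ι`, first and second
# moments of a weighted count, and the Cantelli (one-sided Chebyshev) half of the half-mean small-ball inequality

builds on p205010 (kernel theorem, internal audit signed; external expert review pending)

Support file (`--supports stmt-CriticalPhenomena-4575`), QUANT lane lead (gen 5), rung R8 of
`run/shared/lean/prim/quant/LADDER.md`; memo `run/shared/lean/prim/quant/prim-quant-lead-g5/LEAD-NOTES-G5.md` N12.

**Setting.**  A finite index type `ι` ("blobs"), gates `p : ι → ℝ` (`0 ≤ p i ≤ 1`) and weights `a : ι → ℝ` (`0 ≤ a i`).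
A configuration is the set `W : Finset ι` of open gates; its product-Bernoulli weight is
`(∏ k, if k ∈ W then p k else 1 - p k) = ∏ i, (if i ∈ W then p i else 1 - p i)` and the weighted count is `X W = ∑ i ∈ W, a i`, with mean
`m = ∑ i, a i * p i`.  This is the INDEPENDENT-BLOB CARICATURE of the far-relay row `Quant.FarRelayRow` (LEAD-NOTES-G4 N11 (5)):
an observer `o` joined by one edge of weight `p i` to a glued blob of `a i` relays, blobs disjoint; then
`N_o = X`, `EN_o = m` and `min_a P(o ↔ a) = min_i p i`.

Contents (all elementary, sorry-free, standard axioms):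
* `sum_prod_ite_mem` — `∑_W ∏_i (if i ∈ W then g i else h i) = ∏_i (g i + h i)` (the product formula);
* `sum_bernoulliWeight` (total mass one), `sum_bernoulliWeight_mul_prod_indicator` (`E[∏_{i∈T} 1_{i∈W}] = ∏_{i∈T} p i`),
  `sum_bernoulliWeight_mul_count` (`E[X] = m`), `sum_bernoulliWeight_mul_sq_sub` (`E[(c − X)²] = (c − m)² + ∑ a_i² p_i (1 − p_i)`);
* `halfMean_smallBall_of_gate_le_half` — the CANTELLI HALF of the half-mean small-ball inequality, in the form conditioned on a
  distinguished least reliable gate `(p₀, a₀)` with `p₀ ≤ 1/2`: if every weight is at most `m/2` then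
  `p₀·P(X + a₀ < m/2) + (1 − p₀)·P(X < m/2) ≤ 1 − p₀`, `m = a₀ p₀ + ∑ a_i p_i`.
The other half (all gates `≥ 1/2`, by a Harris–Kleitman/Hall transport) and the assembled theorem are in
`…QuantIndepBlobFar.lean`.
-/

namespace Summit.CriticalPhenomena.PercolationContinuityZ3.Theorems

namespace Quant

namespace IndepBlob

open Finset

variable {ι : Type*} [Fintype ι] [DecidableEq ι]

/-- The product formula: summing `∏_i (if i ∈ W then g i else h i)` over all `W` gives `∏_i (g i + h i)`. [folklore] -/
theorem sum_prod_ite_mem (g h : ι → ℝ) :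
    ∑ W : Finset ι, ∏ i, (if i ∈ W then g i else h i) = ∏ i, (g i + h i) := by
  rw [Finset.prod_add, ← Finset.powerset_univ]
  refine Finset.sum_congr rfl fun W _ => ?_
  rw [Finset.prod_ite]
  congr 1
  · exact Finset.prod_congr (by ext i; simp) fun _ _ => rfl
  · exact Finset.prod_congr (by ext i; simp) fun _ _ => rfl

/-- The weights are nonnegative when `0 ≤ p i ≤ 1`. [this work] -/
theorem bernoulliWeight_nonneg {p : ι → ℝ} (hp0 : ∀ i, 0 ≤ p i) (hp1 : ∀ i, p i ≤ 1) (W : Finset ι) :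
    0 ≤ (∏ k, if k ∈ W then p k else 1 - p k) := by
  refine Finset.prod_nonneg fun i _ => ?_
  split_ifs
  · exact hp0 i
  · linarith [hp1 i]

/-- Total mass one: `∑_W (∏ k, if k ∈ W then p k else 1 - p k) = 1`. [folklore] -/
theorem sum_bernoulliWeight (p : ι → ℝ) : ∑ W : Finset ι, (∏ k, if k ∈ W then p k else 1 - p k) = 1 := by
  rw [sum_prod_ite_mem]
  simp

/-- Mixed moments of the gate indicators: `E[∏_{i∈T} 1_{i ∈ W}] = ∏_{i∈T} p i`. [folklore] -/
theorem sum_bernoulliWeight_mul_prod_indicator (p : ι → ℝ) (T : Finset ι) :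
    ∑ W : Finset ι, (∏ k, if k ∈ W then p k else 1 - p k) * ∏ i ∈ T, (if i ∈ W then (1 : ℝ) else 0) = ∏ i ∈ T, p i := by
  have key : ∀ W : Finset ι, (∏ k, if k ∈ W then p k else 1 - p k) * ∏ i ∈ T, (if i ∈ W then (1 : ℝ) else 0) =
      ∏ i, (if i ∈ W then p i else (if i ∈ T then 0 else 1 - p i)) := by
    intro W
    by_cases hTW : T ⊆ W
    · have h1 : ∏ i ∈ T, (if i ∈ W then (1 : ℝ) else 0) = 1 :=
        Finset.prod_eq_one fun i hi => by simp [hTW hi]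
      rw [h1, mul_one]
      refine Finset.prod_congr rfl fun i _ => ?_
      by_cases hiW : i ∈ W
      · simp [hiW]
      · have hiT : i ∉ T := fun hiT => hiW (hTW hiT)
        simp [hiW, hiT]
    · obtain ⟨i, hiT, hiW⟩ := Finset.not_subset.1 hTW
      have h1 : ∏ i ∈ T, (if i ∈ W then (1 : ℝ) else 0) = 0 :=
        Finset.prod_eq_zero hiT (by simp [hiW])
      have h2 : ∏ i, (if i ∈ W then p i else (if i ∈ T then 0 else 1 - p i)) = 0 :=
        Finset.prod_eq_zero (Finset.mem_univ i) (by simp [hiW, hiT])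
      rw [h1, mul_zero, h2]
  rw [Finset.sum_congr rfl fun W _ => key W, sum_prod_ite_mem]
  have hR : ∏ i ∈ T, p i = ∏ i, (if i ∈ T then p i else 1) := by
    rw [Finset.prod_ite_mem, Finset.univ_inter]
  rw [hR]
  refine Finset.prod_congr rfl fun i _ => ?_
  by_cases hiT : i ∈ T <;> simp [hiT]

/-- One-point marginal: `P(i ∈ W) = p i`. [folklore] -/
theorem sum_bernoulliWeight_mul_indicator (p : ι → ℝ) (i : ι) :
    ∑ W : Finset ι, (∏ k, if k ∈ W then p k else 1 - p k) * (if i ∈ W then (1 : ℝ) else 0) = p i := by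
  have := sum_bernoulliWeight_mul_prod_indicator p {i}
  simpa using this

/-- Complementary one-point marginal: `P(i ∉ W) = 1 - p i`. [folklore] -/
theorem sum_bernoulliWeight_filter_not_mem (p : ι → ℝ) (i : ι) :
    ∑ W ∈ (Finset.univ : Finset (Finset ι)).filter (fun W => i ∉ W), (∏ k, if k ∈ W then p k else 1 - p k) = 1 - p i := by
  have h1 := sum_bernoulliWeight p
  have h2 := sum_bernoulliWeight_mul_indicator p i
  rw [Finset.sum_filter]
  calc ∑ W : Finset ι, (if i ∉ W then (∏ k, if k ∈ W then p k else 1 - p k) else 0)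
      = ∑ W : Finset ι, ((∏ k, if k ∈ W then p k else 1 - p k) -
          (∏ k, if k ∈ W then p k else 1 - p k) * (if i ∈ W then (1 : ℝ) else 0)) :=
        Finset.sum_congr rfl fun W _ => by split_ifs <;> simp
    _ = 1 - p i := by rw [Finset.sum_sub_distrib, h1, h2]

/-- Two-point marginal: `P(i ∈ W ∧ j ∈ W) = p i * p j` for `i ≠ j`. [folklore] -/
theorem sum_bernoulliWeight_mul_indicator_mul_indicator (p : ι → ℝ) {i j : ι} (hij : i ≠ j) :
    ∑ W : Finset ι, (∏ k, if k ∈ W then p k else 1 - p k) * ((if i ∈ W then (1 : ℝ) else 0) * (if j ∈ W then (1 : ℝ) else 0)) =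
      p i * p j := by
  have h := sum_bernoulliWeight_mul_prod_indicator p {i, j}
  rw [Finset.prod_pair hij] at h
  rw [← h]
  refine Finset.sum_congr rfl fun W _ => ?_
  rw [Finset.prod_pair hij]

/-- The weighted count of open gates, `X W = ∑ i ∈ W, a i`, as a sum of indicators. [this work] -/
theorem count_eq_sum_indicator (a : ι → ℝ) (W : Finset ι) :
    ∑ i ∈ W, a i = ∑ i, a i * (if i ∈ W then (1 : ℝ) else 0) := by
  have h1 : ∑ i, a i * (if i ∈ W then (1 : ℝ) else 0) = ∑ i, (if i ∈ W then a i else 0) :=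
    Finset.sum_congr rfl fun i _ => by split_ifs <;> simp
  rw [h1, ← Finset.sum_filter]
  congr 1
  ext i
  simp

/-- First moment: `E[X] = ∑ i, a i * p i`. [folklore] -/
theorem sum_bernoulliWeight_mul_count (p a : ι → ℝ) :
    ∑ W : Finset ι, (∏ k, if k ∈ W then p k else 1 - p k) * ∑ i ∈ W, a i = ∑ i, a i * p i := by
  have e : ∀ W : Finset ι, (∏ k, if k ∈ W then p k else 1 - p k) * ∑ i ∈ W, a i =
      ∑ i, a i * ((∏ k, if k ∈ W then p k else 1 - p k) * (if i ∈ W then (1 : ℝ) else 0)) := by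
    intro W
    rw [count_eq_sum_indicator a W, Finset.mul_sum]
    exact Finset.sum_congr rfl fun i _ => by ring
  rw [Finset.sum_congr rfl fun W _ => e W, Finset.sum_comm]
  refine Finset.sum_congr rfl fun i _ => ?_
  rw [← Finset.mul_sum, sum_bernoulliWeight_mul_indicator]

/-- Centred mixed moments of the gate indicators: `E[(1_i − p_i)(1_j − p_j)] = [i = j]·p_i (1 − p_i)`. [folklore] -/
theorem sum_bernoulliWeight_mul_centred (p : ι → ℝ) (i j : ι) :
    ∑ W : Finset ι, (∏ k, if k ∈ W then p k else 1 - p k) *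
        (((if i ∈ W then (1 : ℝ) else 0) - p i) * ((if j ∈ W then (1 : ℝ) else 0) - p j)) =
      if i = j then p i * (1 - p i) else 0 := by
  have e : ∀ W : Finset ι, (∏ k, if k ∈ W then p k else 1 - p k) *
      (((if i ∈ W then (1 : ℝ) else 0) - p i) * ((if j ∈ W then (1 : ℝ) else 0) - p j)) =
      (∏ k, if k ∈ W then p k else 1 - p k) * ((if i ∈ W then (1 : ℝ) else 0) * (if j ∈ W then (1 : ℝ) else 0))
        - p j * ((∏ k, if k ∈ W then p k else 1 - p k) * (if i ∈ W then (1 : ℝ) else 0))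
        - p i * ((∏ k, if k ∈ W then p k else 1 - p k) * (if j ∈ W then (1 : ℝ) else 0))
        + p i * p j * (∏ k, if k ∈ W then p k else 1 - p k) := fun W => by ring
  rw [Finset.sum_congr rfl fun W _ => e W]
  rw [Finset.sum_add_distrib, Finset.sum_sub_distrib, Finset.sum_sub_distrib, ← Finset.mul_sum, ← Finset.mul_sum,
    ← Finset.mul_sum, sum_bernoulliWeight_mul_indicator, sum_bernoulliWeight_mul_indicator, sum_bernoulliWeight]
  by_cases hij : i = j
  · subst hij
    have hsq : ∀ W : Finset ι, (∏ k, if k ∈ W then p k else 1 - p k) * ((if i ∈ W then (1 : ℝ) else 0) * (if i ∈ W then (1 : ℝ) else 0)) =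
        (∏ k, if k ∈ W then p k else 1 - p k) * (if i ∈ W then (1 : ℝ) else 0) := fun W => by split_ifs <;> simp
    rw [Finset.sum_congr rfl fun W _ => hsq W, sum_bernoulliWeight_mul_indicator, if_pos rfl]
    ring
  · rw [sum_bernoulliWeight_mul_indicator_mul_indicator p hij, if_neg hij]
    ring

/-- Second moment about an arbitrary centre: `E[(c − X)²] = (c − m)² + ∑ i, a i² p i (1 − p i)`, `m = ∑ a i p i`. [folklore] -/
theorem sum_bernoulliWeight_mul_sq_sub (p a : ι → ℝ) (c : ℝ) :
    ∑ W : Finset ι, (∏ k, if k ∈ W then p k else 1 - p k) * (c - ∑ i ∈ W, a i) ^ 2 =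
      (c - ∑ i, a i * p i) ^ 2 + ∑ i, a i ^ 2 * p i * (1 - p i) := by
  set m : ℝ := ∑ i, a i * p i with hm
  -- `X W − m = ∑ i, a i * (1_{i∈W} − p i)`
  have hX : ∀ W : Finset ι, (∑ i ∈ W, a i) - m = ∑ i, a i * ((if i ∈ W then (1 : ℝ) else 0) - p i) := by
    intro W
    rw [count_eq_sum_indicator a W, hm, ← Finset.sum_sub_distrib]
    exact Finset.sum_congr rfl fun i _ => by ring
  -- constant term
  have h0 : ∑ W : Finset ι, (∏ k, if k ∈ W then p k else 1 - p k) * (c - m) ^ 2 = (c - m) ^ 2 := by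
    rw [← Finset.sum_mul, sum_bernoulliWeight, one_mul]
  -- linear term vanishes
  have h1 : ∑ W : Finset ι, (∏ k, if k ∈ W then p k else 1 - p k) * (2 * (c - m) * ((∑ i ∈ W, a i) - m)) = 0 := by
    have e : ∀ W : Finset ι, (∏ k, if k ∈ W then p k else 1 - p k) * (2 * (c - m) * ((∑ i ∈ W, a i) - m)) =
        2 * (c - m) * ((∏ k, if k ∈ W then p k else 1 - p k) * ∑ i ∈ W, a i) - 2 * (c - m) * m * (∏ k, if k ∈ W then p k else 1 - p k) := fun W => by ring
    rw [Finset.sum_congr rfl fun W _ => e W, Finset.sum_sub_distrib, ← Finset.mul_sum, ← Finset.mul_sum,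
      sum_bernoulliWeight_mul_count, sum_bernoulliWeight, ← hm]
    ring
  -- quadratic term
  have inner : ∀ i j : ι, ∑ W : Finset ι, (∏ k, if k ∈ W then p k else 1 - p k) *
      (a i * ((if i ∈ W then (1 : ℝ) else 0) - p i) * (a j * ((if j ∈ W then (1 : ℝ) else 0) - p j))) =
      if i = j then a i * a j * (p i * (1 - p i)) else 0 := by
    intro i j
    have e2 : ∀ W : Finset ι, (∏ k, if k ∈ W then p k else 1 - p k) *
        (a i * ((if i ∈ W then (1 : ℝ) else 0) - p i) * (a j * ((if j ∈ W then (1 : ℝ) else 0) - p j))) =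
        a i * a j * ((∏ k, if k ∈ W then p k else 1 - p k) *
          (((if i ∈ W then (1 : ℝ) else 0) - p i) * ((if j ∈ W then (1 : ℝ) else 0) - p j))) := fun W => by ring
    rw [Finset.sum_congr rfl fun W _ => e2 W, ← Finset.mul_sum, sum_bernoulliWeight_mul_centred p i j]
    split_ifs <;> simp
  have h2 : ∑ W : Finset ι, (∏ k, if k ∈ W then p k else 1 - p k) * ((∑ i ∈ W, a i) - m) ^ 2 = ∑ i, a i ^ 2 * p i * (1 - p i) := by
    have e3 : ∀ W : Finset ι, (∏ k, if k ∈ W then p k else 1 - p k) * ((∑ i ∈ W, a i) - m) ^ 2 =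
        ∑ i, ∑ j, (∏ k, if k ∈ W then p k else 1 - p k) *
          (a i * ((if i ∈ W then (1 : ℝ) else 0) - p i) * (a j * ((if j ∈ W then (1 : ℝ) else 0) - p j))) := by
      intro W
      rw [hX W, sq, Finset.sum_mul_sum, Finset.mul_sum]
      refine Finset.sum_congr rfl fun i _ => ?_
      rw [Finset.mul_sum]
    rw [Finset.sum_congr rfl fun W _ => e3 W, Finset.sum_comm]
    refine Finset.sum_congr rfl fun i _ => ?_
    rw [Finset.sum_comm, Finset.sum_congr rfl fun j _ => inner i j, Finset.sum_ite_eq]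
    simp
    ring
  have hsq : ∀ W : Finset ι, (∏ k, if k ∈ W then p k else 1 - p k) * (c - ∑ i ∈ W, a i) ^ 2 =
      (∏ k, if k ∈ W then p k else 1 - p k) * (c - m) ^ 2 - (∏ k, if k ∈ W then p k else 1 - p k) * (2 * (c - m) * ((∑ i ∈ W, a i) - m)) +
        (∏ k, if k ∈ W then p k else 1 - p k) * ((∑ i ∈ W, a i) - m) ^ 2 := fun W => by ring
  rw [Finset.sum_congr rfl fun W _ => hsq W, Finset.sum_add_distrib, Finset.sum_sub_distrib, h0, h1, h2]
  ring

/-- **Cantelli half of the half-mean small-ball inequality** (least reliable gate `p₀ ≤ 1/2`, no weight above half the mean).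
Data: gates `p : ι → ℝ` and weights `a : ι → ℝ` with `p₀ ≤ p i ≤ 1`, `0 ≤ a i`, plus a distinguished gate `(p₀, a₀)` with
`0 ≤ p₀ ≤ 1/2`, `0 ≤ a₀`; `m = a₀ p₀ + ∑ a i p i` is the mean of the total count `a₀ ε₀ + X`.  If `a₀ ≤ m/2` and every `a i ≤ m/2` then
`p₀ · P(X + a₀ < m/2) + (1 − p₀) · P(X < m/2) ≤ 1 − p₀`, i.e. `P(a₀ε₀ + X < m/2) ≤ 1 − p₀` after conditioning on `ε₀`.
Proof: Cantelli's inequality `P(Y ≤ EY − t) ≤ Var Y/(Var Y + t²)` with `t = m/2` and `Var Y ≤ (m/2)(1 − p₀) m`. [this work] -/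
theorem halfMean_smallBall_of_gate_le_half (p a : ι → ℝ) (p₀ a₀ : ℝ) (hp₀ : 0 ≤ p₀) (hhalf : p₀ ≤ 1 / 2)
    (hp : ∀ i, p₀ ≤ p i) (hp1 : ∀ i, p i ≤ 1) (ha : ∀ i, 0 ≤ a i) (ha₀ : 0 ≤ a₀)
    (hA₀ : a₀ ≤ (a₀ * p₀ + ∑ i, a i * p i) / 2) (hA : ∀ i, a i ≤ (a₀ * p₀ + ∑ i, a i * p i) / 2) :
    p₀ * (∑ W ∈ (Finset.univ : Finset (Finset ι)).filter
        (fun W => ∑ i ∈ W, a i + a₀ < (a₀ * p₀ + ∑ i, a i * p i) / 2), (∏ k, if k ∈ W then p k else 1 - p k)) +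
      (1 - p₀) * (∑ W ∈ (Finset.univ : Finset (Finset ι)).filter
        (fun W => ∑ i ∈ W, a i < (a₀ * p₀ + ∑ i, a i * p i) / 2), (∏ k, if k ∈ W then p k else 1 - p k)) ≤ 1 - p₀ := by
  set m' : ℝ := ∑ i, a i * p i with hm'
  set t : ℝ := (a₀ * p₀ + m') / 2 with ht
  set V' : ℝ := ∑ i, a i ^ 2 * p i * (1 - p i) with hV'
  set V : ℝ := a₀ ^ 2 * p₀ * (1 - p₀) + V' with hV
  set L := (Finset.univ : Finset (Finset ι)).filter (fun W => ∑ i ∈ W, a i + a₀ < t) with hL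
  set K := (Finset.univ : Finset (Finset ι)).filter (fun W => ∑ i ∈ W, a i < t) with hK
  set SL : ℝ := ∑ W ∈ L, (∏ k, if k ∈ W then p k else 1 - p k) with hSL
  set SK : ℝ := ∑ W ∈ K, (∏ k, if k ∈ W then p k else 1 - p k) with hSK
  set P : ℝ := p₀ * SL + (1 - p₀) * SK with hP
  show P ≤ 1 - p₀
  have hf0 : 0 ≤ 1 - p₀ := by linarith
  have hw0 : ∀ W, 0 ≤ (∏ k, if k ∈ W then p k else 1 - p k) := bernoulliWeight_nonneg (fun i => hp₀.trans (hp i)) hp1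
  have hm'0 : 0 ≤ m' := Finset.sum_nonneg fun i _ => mul_nonneg (ha i) (hp₀.trans (hp i))
  have ht0 : 0 ≤ t := by rw [ht]; nlinarith [mul_nonneg ha₀ hp₀]
  have hSL0 : 0 ≤ SL := Finset.sum_nonneg fun W _ => hw0 W
  have hSK0 : 0 ≤ SK := Finset.sum_nonneg fun W _ => hw0 W
  have hSL1 : SL ≤ 1 := by
    rw [← sum_bernoulliWeight p]
    exact Finset.sum_le_sum_of_subset_of_nonneg (Finset.filter_subset _ _) fun W _ _ => hw0 W
  have hSK1 : SK ≤ 1 := by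
    rw [← sum_bernoulliWeight p]
    exact Finset.sum_le_sum_of_subset_of_nonneg (Finset.filter_subset _ _) fun W _ _ => hw0 W
  have hP0 : 0 ≤ P := add_nonneg (mul_nonneg hp₀ hSL0) (mul_nonneg hf0 hSK0)
  have hP1 : P ≤ 1 := by
    have h1 : p₀ * SL ≤ p₀ * 1 := mul_le_mul_of_nonneg_left hSL1 hp₀
    have h2 : (1 - p₀) * SK ≤ (1 - p₀) * 1 := mul_le_mul_of_nonneg_left hSK1 hf0
    linarith
  -- degenerate mean: both events are empty
  rcases eq_or_lt_of_le ht0 with ht00 | htpos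
  · have hL0 : SL = 0 := by
      refine Finset.sum_eq_zero fun W hW => ?_
      rw [hL, Finset.mem_filter] at hW
      have : 0 ≤ ∑ i ∈ W, a i := Finset.sum_nonneg fun i _ => ha i
      linarith [hW.2]
    have hK0 : SK = 0 := by
      refine Finset.sum_eq_zero fun W hW => ?_
      rw [hK, Finset.mem_filter] at hW
      have : 0 ≤ ∑ i ∈ W, a i := Finset.sum_nonneg fun i _ => ha i
      linarith [hW.2]
    rw [hP, hL0, hK0]; linarith
  -- the variance bound `V ≤ 2 (1 − p₀) t²`
  have hVle : V ≤ 2 * (1 - p₀) * t ^ 2 := by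
    have h1 : a₀ ^ 2 * p₀ * (1 - p₀) ≤ t * (1 - p₀) * (a₀ * p₀) := by
      have c0 : 0 ≤ a₀ * p₀ * (1 - p₀) := mul_nonneg (mul_nonneg ha₀ hp₀) hf0
      have := mul_le_mul_of_nonneg_right hA₀ c0
      calc a₀ ^ 2 * p₀ * (1 - p₀) = a₀ * (a₀ * p₀ * (1 - p₀)) := by ring
        _ ≤ t * (a₀ * p₀ * (1 - p₀)) := by rw [ht]; exact this
        _ = t * (1 - p₀) * (a₀ * p₀) := by ring
    have h2 : V' ≤ t * (1 - p₀) * m' := by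
      rw [hV', hm', Finset.mul_sum]
      refine Finset.sum_le_sum fun i _ => ?_
      have hpi0 : 0 ≤ p i := hp₀.trans (hp i)
      have e1 : a i ^ 2 * p i * (1 - p i) ≤ a i ^ 2 * p i * (1 - p₀) := by
        have : 1 - p i ≤ 1 - p₀ := by linarith [hp i]
        exact mul_le_mul_of_nonneg_left this (by positivity)
      have e2 : a i ^ 2 * p i * (1 - p₀) ≤ t * (1 - p₀) * (a i * p i) := by
        have c0 : 0 ≤ a i * p i * (1 - p₀) := mul_nonneg (mul_nonneg (ha i) hpi0) hf0
        have := mul_le_mul_of_nonneg_right (hA i) c0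
        calc a i ^ 2 * p i * (1 - p₀) = a i * (a i * p i * (1 - p₀)) := by ring
          _ ≤ t * (a i * p i * (1 - p₀)) := by rw [ht]; exact this
          _ = t * (1 - p₀) * (a i * p i) := by ring
      exact e1.trans e2
    have e : t * (1 - p₀) * (a₀ * p₀) + t * (1 - p₀) * m' = 2 * (1 - p₀) * t ^ 2 := by
      rw [ht]; ring
    rw [hV]; linarith
  have hV'0 : 0 ≤ V' := Finset.sum_nonneg fun i _ => by
    have hpi0 : 0 ≤ p i := hp₀.trans (hp i)
    have : 0 ≤ 1 - p i := by linarith [hp1 i]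
    positivity
  have hV0 : 0 ≤ V := by
    have h2 : 0 ≤ a₀ ^ 2 * p₀ * (1 - p₀) := by positivity
    rw [hV]; linarith
  -- the Cantelli step: `(t + u)² P ≤ V + u²` for every `u ≥ 0`
  have cantelli : ∀ u : ℝ, 0 ≤ u → (t + u) ^ 2 * P ≤ V + u ^ 2 := by
    intro u hu
    have q1 := sum_bernoulliWeight_mul_sq_sub p a (2 * t - a₀ + u)
    have q0 := sum_bernoulliWeight_mul_sq_sub p a (2 * t + u)
    rw [← hm'] at q1 q0
    -- pointwise lower bounds on the two events
    have b1 : (t + u) ^ 2 * SL ≤ ∑ W : Finset ι, (∏ k, if k ∈ W then p k else 1 - p k) * (2 * t - a₀ + u - ∑ i ∈ W, a i) ^ 2 := by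
      rw [hSL, Finset.mul_sum]
      calc ∑ W ∈ L, (t + u) ^ 2 * (∏ k, if k ∈ W then p k else 1 - p k)
          ≤ ∑ W ∈ L, (∏ k, if k ∈ W then p k else 1 - p k) * (2 * t - a₀ + u - ∑ i ∈ W, a i) ^ 2 := by
            refine Finset.sum_le_sum fun W hW => ?_
            rw [hL, Finset.mem_filter] at hW
            have hge : t + u ≤ 2 * t - a₀ + u - ∑ i ∈ W, a i := by linarith [hW.2]
            have hsq : (t + u) ^ 2 ≤ (2 * t - a₀ + u - ∑ i ∈ W, a i) ^ 2 :=
              pow_le_pow_left₀ (by linarith) hge 2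
            rw [mul_comm]
            exact mul_le_mul_of_nonneg_left hsq (hw0 W)
        _ ≤ ∑ W : Finset ι, (∏ k, if k ∈ W then p k else 1 - p k) * (2 * t - a₀ + u - ∑ i ∈ W, a i) ^ 2 :=
            Finset.sum_le_sum_of_subset_of_nonneg (Finset.filter_subset _ _)
              fun W _ _ => mul_nonneg (hw0 W) (sq_nonneg _)
    have b0 : (t + u) ^ 2 * SK ≤ ∑ W : Finset ι, (∏ k, if k ∈ W then p k else 1 - p k) * (2 * t + u - ∑ i ∈ W, a i) ^ 2 := by
      rw [hSK, Finset.mul_sum]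
      calc ∑ W ∈ K, (t + u) ^ 2 * (∏ k, if k ∈ W then p k else 1 - p k)
          ≤ ∑ W ∈ K, (∏ k, if k ∈ W then p k else 1 - p k) * (2 * t + u - ∑ i ∈ W, a i) ^ 2 := by
            refine Finset.sum_le_sum fun W hW => ?_
            rw [hK, Finset.mem_filter] at hW
            have hge : t + u ≤ 2 * t + u - ∑ i ∈ W, a i := by linarith [hW.2]
            have hsq : (t + u) ^ 2 ≤ (2 * t + u - ∑ i ∈ W, a i) ^ 2 :=
              pow_le_pow_left₀ (by linarith) hge 2
            rw [mul_comm]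
            exact mul_le_mul_of_nonneg_left hsq (hw0 W)
        _ ≤ ∑ W : Finset ι, (∏ k, if k ∈ W then p k else 1 - p k) * (2 * t + u - ∑ i ∈ W, a i) ^ 2 :=
            Finset.sum_le_sum_of_subset_of_nonneg (Finset.filter_subset _ _)
              fun W _ _ => mul_nonneg (hw0 W) (sq_nonneg _)
    have e : p₀ * ((2 * t - a₀ + u - m') ^ 2 + V') + (1 - p₀) * ((2 * t + u - m') ^ 2 + V') = V + u ^ 2 := by
      rw [hV, ht]; ring
    calc (t + u) ^ 2 * P = p₀ * ((t + u) ^ 2 * SL) + (1 - p₀) * ((t + u) ^ 2 * SK) := by rw [hP]; ring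
      _ ≤ p₀ * ((2 * t - a₀ + u - m') ^ 2 + V') + (1 - p₀) * ((2 * t + u - m') ^ 2 + V') := by
          rw [← q1, ← q0]
          exact add_le_add (mul_le_mul_of_nonneg_left b1 hp₀) (mul_le_mul_of_nonneg_left b0 hf0)
      _ = V + u ^ 2 := e
  -- choose `u = V / t`
  have hc := cantelli (V / t) (div_nonneg hV0 htpos.le)
  have htne : t ≠ 0 := htpos.ne'
  have e3 : (t + V / t) * t = t ^ 2 + V := by
    field_simp
  have lhs : (t + V / t) ^ 2 * P * t ^ 2 = (t ^ 2 + V) ^ 2 * P := by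
    rw [← e3]; ring
  have rhs : (V + (V / t) ^ 2) * t ^ 2 = V * (t ^ 2 + V) := by
    field_simp
  have h4 : (t ^ 2 + V) ^ 2 * P ≤ V * (t ^ 2 + V) := by
    have := mul_le_mul_of_nonneg_right hc (sq_nonneg t)
    rw [lhs, rhs] at this
    exact this
  have hpos : 0 < t ^ 2 + V := by positivity
  have key : (t ^ 2 + V) * P ≤ V := by
    have h5 : (t ^ 2 + V) * ((t ^ 2 + V) * P) ≤ (t ^ 2 + V) * V := by
      calc (t ^ 2 + V) * ((t ^ 2 + V) * P) = (t ^ 2 + V) ^ 2 * P := by ring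
        _ ≤ V * (t ^ 2 + V) := h4
        _ = (t ^ 2 + V) * V := by ring
    exact le_of_mul_le_mul_left h5 hpos
  -- conclude: `t² P ≤ V (1 − P) ≤ 2 (1 − p₀) t² (1 − P)`, so `P ≤ 2 (1 − p₀)(1 − P)`, so `P ≤ 1 − p₀` as `p₀ ≤ 1/2`
  have ht2 : 0 < t ^ 2 := by positivity
  have s1 : t ^ 2 * P ≤ V * (1 - P) := by linear_combination key
  have s2 : V * (1 - P) ≤ 2 * (1 - p₀) * t ^ 2 * (1 - P) := mul_le_mul_of_nonneg_right hVle (by linarith)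
  have s3 : P ≤ 2 * (1 - p₀) * (1 - P) := by
    refine le_of_mul_le_mul_left ?_ ht2
    calc t ^ 2 * P ≤ 2 * (1 - p₀) * t ^ 2 * (1 - P) := s1.trans s2
      _ = t ^ 2 * (2 * (1 - p₀) * (1 - P)) := by ring
  have s4 : P * (1 + 2 * (1 - p₀)) ≤ (1 - p₀) * (1 + 2 * (1 - p₀)) := by nlinarith [s3, hhalf, hf0]
  exact le_of_mul_le_mul_right s4 (by linarith)

end IndepBlob

end Quant

end Summit.CriticalPhenomena.PercolationContinuityZ3.Theorems
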